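import Summits.AtomisticToContinuum.HydrodynamicLimit.Theorems.OneFlightGossipEngineEquilibriumClampedCollisionalWindowLDDefs

/-!
# A one-sided window-LD template closed under sums, positive scalings and `o(N)` shifts
(line `radial-virial-polarization` of the crux `EquilibriumClampedCollisionalWindowLD`, stmt-AtomisticToContinuum-13733)

Generic measure-theoretic bookkeeping used by the line's composition (`…RadialVirialAssembly`): for a family of laws `μ N` on
`Phase N` and a family of window functionals `Y τ V N : Phase N → ℝ`,

* `UpperLD μ Y` (one-field structures throughout, predicates of the line) — `∃V₀ ∀V≥V₀ ∃β₀ ∀β∈[0,β₀] ∀ε>0 ∃τ₀ ∀τ≥τ₀ ∃N₀ ∀N≥N₀: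
  ∫ exp(β Y) dμ_N ≤ exp(ε(N+1))` (the crux's quantifier frame, one-sided in `β`); `TwoSidedLD` (`|β| ≤ β₀`) through the common prefix
  `LDPrefix`; `AEMeasFam` (a.e.-measurability on the range);
* closure: `UpperLD.add` (exponential midpoint convexity `exp((x+y)/2) ≤ (eˣ+eʸ)/2` — the only place measurability enters, to split a
  `lintegral` of a sum), `UpperLD.const_mul` (positive scalings), `UpperLD.add_small` (adding a functional bounded a.e. by
  `C V (N+1)^{2/3} = o(N)`), `TwoSidedLD.of_upper` / `.upper` / `.upper_neg`, `LDPrefix.and/.mono/.forall_fin3`.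

Elementary (Mathlib: `lintegral_add_left'`, `lintegral_const_mul'`, `lintegral_mono_ae`, `Real.rpow_*`); no hard-sphere input.
prover-line-stmt-AtomisticToContinuum-13733-c2-0, 2026-08-16.
-/

noncomputable section

open MeasureTheory Set Filter
open scoped ENNReal BigOperators
open Literature.Analysis.FluidPDE Literature.MathematicalPhysics.KineticTheory

namespace Summit.AtomisticToContinuum.HydrodynamicLimit.Theorems.ClampedTransferCoin

namespace RadialVirial

/-! ### The LD template -/

/-- A family of window functionals: `Y τ V N : Phase N → ℝ`. -/
abbrev WFun : Type := (τ V : ℝ) → (N : ℕ) → Phase N → ℝ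

/-- The LD ceiling `exp(ε (N+1))`. -/
def ldBound (ε : ℝ) (N : ℕ) : ℝ≥0∞ := ENNReal.ofReal (Real.exp (ε * ((N : ℝ) + 1)))

/-- Exponential moment `∫ exp(β Y) dμ`. -/
def expMom {N : ℕ} (μ : Measure (Phase N)) (β : ℝ) (Y : Phase N → ℝ) : ℝ≥0∞ :=
  ∫⁻ z, ENNReal.ofReal (Real.exp (β * Y z)) ∂μ

/-- The common quantifier prefix `∃V₀ ∀V ∃β₀ ∀|β|≤β₀ ∀ε ∃τ₀ ∀τ ∃N₀ ∀N` over a bound `B V β ε τ N` (a one-field structure, so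
that it is a predicate of the line and not a named statement). -/
structure LDPrefix (B : ℝ → ℝ → ℝ → ℝ → ℕ → Prop) : Prop where
  /-- the quantifier block -/
  out : ∃ V₀ : ℝ, 0 < V₀ ∧ ∀ V : ℝ, V₀ ≤ V → ∃ β₀ : ℝ, 0 < β₀ ∧ ∀ β : ℝ, |β| ≤ β₀ →
    ∀ ε : ℝ, 0 < ε → ∃ τ₀ : ℝ, 0 < τ₀ ∧ ∀ τ : ℝ, τ₀ ≤ τ → ∃ N₀ : ℕ, ∀ N : ℕ, N₀ ≤ N → B V β ε τ N

/-- The ONE-SIDED window-LD template for a family `Y` under the laws `μ N`: `0 ≤ β ≤ β₀`. -/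
structure UpperLD (μ : (N : ℕ) → Measure (Phase N)) (Y : WFun) : Prop where
  /-- the quantifier block -/
  out : ∃ V₀ : ℝ, 0 < V₀ ∧ ∀ V : ℝ, V₀ ≤ V → ∃ β₀ : ℝ, 0 < β₀ ∧ ∀ β : ℝ, 0 ≤ β → β ≤ β₀ →
    ∀ ε : ℝ, 0 < ε → ∃ τ₀ : ℝ, 0 < τ₀ ∧ ∀ τ : ℝ, τ₀ ≤ τ → ∃ N₀ : ℕ, ∀ N : ℕ, N₀ ≤ N →
      expMom (μ N) β (Y τ V N) ≤ ldBound ε N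

/-- The TWO-SIDED template: `|β| ≤ β₀`. -/
structure TwoSidedLD (μ : (N : ℕ) → Measure (Phase N)) (Y : WFun) : Prop where
  /-- the prefix over the exponential-moment bound -/
  out : LDPrefix fun V β ε τ N => expMom (μ N) β (Y τ V N) ≤ ldBound ε N

/-- A.e.-measurability of a family on the relevant parameter range. -/
structure AEMeasFam (μ : (N : ℕ) → Measure (Phase N)) (Y : WFun) : Prop where
  /-- measurability for `τ > 0`, `V ≥ 0` -/
  out : ∀ τ V N, 0 < τ → 0 ≤ V → AEMeasurable (Y τ V N) (μ N)

section Template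

variable {μ : (N : ℕ) → Measure (Phase N)}

/-- Monotonicity of the prefix in the bound. -/
theorem LDPrefix.mono {P Q : ℝ → ℝ → ℝ → ℝ → ℕ → Prop} (hPQ : ∀ V β ε τ N, P V β ε τ N → Q V β ε τ N)
    (h : LDPrefix P) : LDPrefix Q := by
  obtain ⟨V₀, hV₀, h⟩ := h.out
  refine ⟨⟨V₀, hV₀, fun V hV => ?_⟩⟩
  obtain ⟨β₀, hβ₀, h⟩ := h V hV
  refine ⟨β₀, hβ₀, fun β hβ ε hε => ?_⟩
  obtain ⟨τ₀, hτ₀, h⟩ := h β hβ ε hε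
  refine ⟨τ₀, hτ₀, fun τ hτ => ?_⟩
  obtain ⟨N₀, h⟩ := h τ hτ
  exact ⟨N₀, fun N hN => hPQ _ _ _ _ _ (h N hN)⟩

/-- Two prefixes combine (thresholds `max / min / max / max`). -/
theorem LDPrefix.and {P Q : ℝ → ℝ → ℝ → ℝ → ℕ → Prop} (hP : LDPrefix P) (hQ : LDPrefix Q) :
    LDPrefix fun V β ε τ N => P V β ε τ N ∧ Q V β ε τ N := by
  obtain ⟨V₁, hV₁, hP⟩ := hP.out
  obtain ⟨V₂, hV₂, hQ⟩ := hQ.out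
  refine ⟨⟨max V₁ V₂, lt_max_of_lt_left hV₁, fun V hV => ?_⟩⟩
  obtain ⟨b₁, hb₁, hP⟩ := hP V ((le_max_left _ _).trans hV)
  obtain ⟨b₂, hb₂, hQ⟩ := hQ V ((le_max_right _ _).trans hV)
  refine ⟨min b₁ b₂, lt_min hb₁ hb₂, fun β hβ ε hε => ?_⟩
  obtain ⟨t₁, ht₁, hP⟩ := hP β (hβ.trans (min_le_left _ _)) ε hε
  obtain ⟨t₂, ht₂, hQ⟩ := hQ β (hβ.trans (min_le_right _ _)) ε hε
  refine ⟨max t₁ t₂, lt_max_of_lt_left ht₁, fun τ hτ => ?_⟩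
  obtain ⟨N₁, hP⟩ := hP τ ((le_max_left _ _).trans hτ)
  obtain ⟨N₂, hQ⟩ := hQ τ ((le_max_right _ _).trans hτ)
  exact ⟨max N₁ N₂, fun N hN => ⟨hP N ((le_max_left _ _).trans hN), hQ N ((le_max_right _ _).trans hN)⟩⟩

/-- Three prefixes combine into one over `∀ k : Fin 3`. -/
theorem LDPrefix.forall_fin3 {P : Fin 3 → ℝ → ℝ → ℝ → ℝ → ℕ → Prop} (h : ∀ k, LDPrefix (P k)) :
    LDPrefix fun V β ε τ N => ∀ k, P k V β ε τ N := by
  refine LDPrefix.mono ?_ (((h 0).and (h 1)).and (h 2))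
  intro V β ε τ N hk k
  fin_cases k
  · exact hk.1.1
  · exact hk.1.2
  · exact hk.2

/-- Midpoint convexity of the exponential. -/
theorem exp_half_add_le (x y : ℝ) : Real.exp ((x + y) / 2) ≤ (Real.exp x + Real.exp y) / 2 := by
  have hx : Real.exp x = Real.exp (x / 2) ^ 2 := by rw [sq, ← Real.exp_add]; ring_nf
  have hy : Real.exp y = Real.exp (y / 2) ^ 2 := by rw [sq, ← Real.exp_add]; ring_nf
  have hm : Real.exp ((x + y) / 2) = Real.exp (x / 2) * Real.exp (y / 2) := by rw [← Real.exp_add]; ring_nf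
  rw [hx, hy, hm]
  nlinarith [sq_nonneg (Real.exp (x / 2) - Real.exp (y / 2))]

/-- `∫ exp(β (Y₁ + Y₂)) ≤ ½ ∫ exp(2β Y₁) + ½ ∫ exp(2β Y₂)`. -/
theorem expMom_add_le {N : ℕ} (ν : Measure (Phase N)) (β : ℝ) {Y₁ Y₂ : Phase N → ℝ}
    (h₁ : AEMeasurable Y₁ ν) :
    expMom ν β (fun z => Y₁ z + Y₂ z) ≤
      2⁻¹ * expMom ν (2 * β) Y₁ + 2⁻¹ * expMom ν (2 * β) Y₂ := by
  unfold expMom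
  have hpt : ∀ z, ENNReal.ofReal (Real.exp (β * (Y₁ z + Y₂ z))) ≤
      ENNReal.ofReal 2⁻¹ * ENNReal.ofReal (Real.exp (2 * β * Y₁ z)) +
        ENNReal.ofReal 2⁻¹ * ENNReal.ofReal (Real.exp (2 * β * Y₂ z)) := by
    intro z
    have h := exp_half_add_le (2 * β * Y₁ z) (2 * β * Y₂ z)
    have e : (2 * β * Y₁ z + 2 * β * Y₂ z) / 2 = β * (Y₁ z + Y₂ z) := by ring
    rw [e] at h
    rw [← ENNReal.ofReal_mul (by norm_num), ← ENNReal.ofReal_mul (by norm_num),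
      ← ENNReal.ofReal_add (by positivity) (by positivity)]
    exact ENNReal.ofReal_le_ofReal (by linarith)
  have hm : AEMeasurable (fun z => ENNReal.ofReal 2⁻¹ * ENNReal.ofReal (Real.exp (2 * β * Y₁ z))) ν :=
    (ENNReal.measurable_ofReal.comp_aemeasurable
      (Real.measurable_exp.comp_aemeasurable (h₁.const_mul (2 * β)))).const_mul _
  calc ∫⁻ z, ENNReal.ofReal (Real.exp (β * (Y₁ z + Y₂ z))) ∂ν
      ≤ ∫⁻ z, (ENNReal.ofReal 2⁻¹ * ENNReal.ofReal (Real.exp (2 * β * Y₁ z)) +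
          ENNReal.ofReal 2⁻¹ * ENNReal.ofReal (Real.exp (2 * β * Y₂ z))) ∂ν := lintegral_mono hpt
    _ = ∫⁻ z, ENNReal.ofReal 2⁻¹ * ENNReal.ofReal (Real.exp (2 * β * Y₁ z)) ∂ν +
          ∫⁻ z, ENNReal.ofReal 2⁻¹ * ENNReal.ofReal (Real.exp (2 * β * Y₂ z)) ∂ν := lintegral_add_left' hm _
    _ = 2⁻¹ * ∫⁻ z, ENNReal.ofReal (Real.exp (2 * β * Y₁ z)) ∂ν +
          2⁻¹ * ∫⁻ z, ENNReal.ofReal (Real.exp (2 * β * Y₂ z)) ∂ν := by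
        rw [lintegral_const_mul' _ _ ENNReal.ofReal_ne_top, lintegral_const_mul' _ _ ENNReal.ofReal_ne_top,
          ENNReal.ofReal_inv_of_pos (by norm_num : (0 : ℝ) < 2), ENNReal.ofReal_ofNat]

/-- **Closure under sums.** -/
theorem UpperLD.add {Y₁ Y₂ : WFun} (h₁ : UpperLD μ Y₁) (h₂ : UpperLD μ Y₂) (hm₁ : AEMeasFam μ Y₁) :
    UpperLD μ (fun τ V N z => Y₁ τ V N z + Y₂ τ V N z) := by
  obtain ⟨V₁, hV₁, h₁⟩ := h₁.out
  obtain ⟨V₂, hV₂, h₂⟩ := h₂.out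
  refine ⟨⟨max V₁ V₂, lt_max_of_lt_left hV₁, fun V hV => ?_⟩⟩
  have hV0 : 0 ≤ V := (hV₁.le.trans (le_max_left _ _)).trans hV
  obtain ⟨b₁, hb₁, h₁⟩ := h₁ V ((le_max_left _ _).trans hV)
  obtain ⟨b₂, hb₂, h₂⟩ := h₂ V ((le_max_right _ _).trans hV)
  refine ⟨min b₁ b₂ / 2, by positivity, fun β hβ0 hβ ε hε => ?_⟩
  have hβ₁ : 2 * β ≤ b₁ := by linarith [min_le_left b₁ b₂]
  have hβ₂ : 2 * β ≤ b₂ := by linarith [min_le_right b₁ b₂]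
  obtain ⟨t₁, ht₁, h₁⟩ := h₁ (2 * β) (by positivity) hβ₁ ε hε
  obtain ⟨t₂, ht₂, h₂⟩ := h₂ (2 * β) (by positivity) hβ₂ ε hε
  refine ⟨max t₁ t₂, lt_max_of_lt_left ht₁, fun τ hτ => ?_⟩
  have hτ0 : 0 < τ := ht₁.trans_le ((le_max_left _ _).trans hτ)
  obtain ⟨N₁, h₁⟩ := h₁ τ ((le_max_left _ _).trans hτ)
  obtain ⟨N₂, h₂⟩ := h₂ τ ((le_max_right _ _).trans hτ)
  refine ⟨max N₁ N₂, fun N hN => ?_⟩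
  have e₁ := h₁ N ((le_max_left _ _).trans hN)
  have e₂ := h₂ N ((le_max_right _ _).trans hN)
  calc expMom (μ N) β (fun z => Y₁ τ V N z + Y₂ τ V N z)
      ≤ 2⁻¹ * expMom (μ N) (2 * β) (Y₁ τ V N) + 2⁻¹ * expMom (μ N) (2 * β) (Y₂ τ V N) :=
        expMom_add_le (μ N) β (hm₁.out τ V N hτ0 hV0)
    _ ≤ 2⁻¹ * ldBound ε N + 2⁻¹ * ldBound ε N := by gcongr
    _ = ldBound ε N := by rw [← two_mul, ← mul_assoc, ENNReal.mul_inv_cancel (by norm_num) (by norm_num), one_mul]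

/-- **Closure under positive scalings.** -/
theorem UpperLD.const_mul {Y : WFun} (c : ℝ) (hc : 0 < c) (h : UpperLD μ Y) :
    UpperLD μ (fun τ V N z => c * Y τ V N z) := by
  obtain ⟨V₀, hV₀, h⟩ := h.out
  refine ⟨⟨V₀, hV₀, fun V hV => ?_⟩⟩
  obtain ⟨β₀, hβ₀, h⟩ := h V hV
  refine ⟨β₀ / c, div_pos hβ₀ hc, fun β hβ0 hβ ε hε => ?_⟩
  have hβc : β * c ≤ β₀ := by rwa [le_div_iff₀ hc] at hβ
  obtain ⟨τ₀, hτ₀, h⟩ := h (β * c) (by positivity) hβc ε hε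
  refine ⟨τ₀, hτ₀, fun τ hτ => ?_⟩
  obtain ⟨N₀, h⟩ := h τ hτ
  refine ⟨N₀, fun N hN => ?_⟩
  have e : expMom (μ N) β (fun z => c * Y τ V N z) = expMom (μ N) (β * c) (Y τ V N) := by
    unfold expMom
    refine lintegral_congr fun z => ?_
    rw [mul_assoc]
  rw [e]
  exact h N hN

/-- Negation as a scaling by `-1` composed with the one-sided template is NOT available (sign of `β`); what we use instead is
that `UpperLD μ (-Y)` is a separate datum. Convenience: rewriting `β * -y`. -/
theorem expMom_neg {N : ℕ} (ν : Measure (Phase N)) (β : ℝ) (Y : Phase N → ℝ) :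
    expMom ν β (fun z => -Y z) = expMom ν (-β) Y := by
  unfold expMom
  refine lintegral_congr fun z => ?_
  rw [mul_neg, neg_mul]

/-- `A (N+1)^{2/3} ≤ ε (N+1)` eventually. -/
theorem eventually_two_thirds_le (A : ℝ) {ε : ℝ} (hε : 0 < ε) :
    ∃ N₀ : ℕ, ∀ N : ℕ, N₀ ≤ N → A * ((N : ℝ) + 1) ^ (2 / 3 : ℝ) ≤ ε * ((N : ℝ) + 1) := by
  rcases le_or_gt A 0 with hA | hA
  · refine ⟨0, fun N _ => ?_⟩
    have h1 : A * ((N : ℝ) + 1) ^ (2 / 3 : ℝ) ≤ 0 :=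
      mul_nonpos_of_nonpos_of_nonneg hA (Real.rpow_nonneg (by positivity) _)
    have h2 : 0 ≤ ε * ((N : ℝ) + 1) := by positivity
    linarith
  · refine ⟨⌈(A / ε) ^ 3⌉₊, fun N hN => ?_⟩
    have hx : 0 < (N : ℝ) + 1 := by positivity
    have hq : (A / ε) ^ 3 ≤ (N : ℝ) + 1 := by
      have := (Nat.le_ceil ((A / ε) ^ 3)).trans (Nat.cast_le.2 hN)
      linarith
    have hAε : 0 < A / ε := div_pos hA hε
    -- `A/ε ≤ (N+1)^{1/3}`
    have h13 : A / ε ≤ ((N : ℝ) + 1) ^ (1 / 3 : ℝ) := by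
      have e : A / ε = ((A / ε) ^ 3) ^ (1 / 3 : ℝ) := by
        rw [← Real.rpow_natCast, ← Real.rpow_mul hAε.le]
        norm_num
      rw [e]
      exact Real.rpow_le_rpow (by positivity) hq (by norm_num)
    have hsplit : ((N : ℝ) + 1) = ((N : ℝ) + 1) ^ (1 / 3 : ℝ) * ((N : ℝ) + 1) ^ (2 / 3 : ℝ) := by
      rw [← Real.rpow_add hx]
      norm_num
    have h23 : 0 ≤ ((N : ℝ) + 1) ^ (2 / 3 : ℝ) := Real.rpow_nonneg hx.le _
    calc A * ((N : ℝ) + 1) ^ (2 / 3 : ℝ) = ε * (A / ε) * ((N : ℝ) + 1) ^ (2 / 3 : ℝ) := by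
          field_simp
      _ ≤ ε * ((N : ℝ) + 1) ^ (1 / 3 : ℝ) * ((N : ℝ) + 1) ^ (2 / 3 : ℝ) := by gcongr
      _ = ε * ((N : ℝ) + 1) := by rw [mul_assoc, ← hsplit]

/-- **Closure under `o(N)` shifts**: adding a functional bounded a.e. by `C V (N+1)^{2/3}`. -/
theorem UpperLD.add_small {Y R : WFun} (h : UpperLD μ Y) (C : ℝ)
    (hR : ∀ τ V N, 0 < τ → 0 ≤ V → ∀ᵐ z ∂(μ N), |R τ V N z| ≤ C * V * ((N : ℝ) + 1) ^ (2 / 3 : ℝ)) :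
    UpperLD μ (fun τ V N z => Y τ V N z + R τ V N z) := by
  obtain ⟨V₀, hV₀, h⟩ := h.out
  refine ⟨⟨V₀, hV₀, fun V hV => ?_⟩⟩
  have hV0 : 0 ≤ V := hV₀.le.trans hV
  obtain ⟨β₀, hβ₀, h⟩ := h V hV
  refine ⟨β₀, hβ₀, fun β hβ0 hβ ε hε => ?_⟩
  obtain ⟨τ₀, hτ₀, h⟩ := h β hβ0 hβ (ε / 2) (half_pos hε)
  refine ⟨τ₀, hτ₀, fun τ hτ => ?_⟩
  have hτ0 : 0 < τ := hτ₀.trans_le hτ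
  obtain ⟨N₁, h⟩ := h τ hτ
  obtain ⟨N₂, hsmall⟩ := eventually_two_thirds_le (β * (C * V)) (half_pos hε)
  refine ⟨max N₁ N₂, fun N hN => ?_⟩
  have hN₁ : N₁ ≤ N := (le_max_left _ _).trans hN
  have hN₂ : N₂ ≤ N := (le_max_right _ _).trans hN
  have hs := hsmall N hN₂
  set D : ℝ := β * (C * V * ((N : ℝ) + 1) ^ (2 / 3 : ℝ)) with hD
  have hDle : D ≤ ε / 2 * ((N : ℝ) + 1) := by rw [hD]; nlinarith [hs]
  -- pointwise a.e.
  have hpt : ∀ᵐ z ∂(μ N), ENNReal.ofReal (Real.exp (β * (Y τ V N z + R τ V N z))) ≤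
      ENNReal.ofReal (Real.exp (ε / 2 * ((N : ℝ) + 1))) * ENNReal.ofReal (Real.exp (β * Y τ V N z)) := by
    filter_upwards [hR τ V N hτ0 hV0] with z hz
    rw [← ENNReal.ofReal_mul (by positivity), ← Real.exp_add]
    refine ENNReal.ofReal_le_ofReal (Real.exp_le_exp.2 ?_)
    have h1 : β * R τ V N z ≤ D := by
      rw [hD]
      exact (mul_le_mul_of_nonneg_left ((le_abs_self _).trans hz) hβ0)
    nlinarith
  calc expMom (μ N) β (fun z => Y τ V N z + R τ V N z)
      ≤ ∫⁻ z, ENNReal.ofReal (Real.exp (ε / 2 * ((N : ℝ) + 1))) * ENNReal.ofReal (Real.exp (β * Y τ V N z)) ∂(μ N) :=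
        lintegral_mono_ae hpt
    _ = ENNReal.ofReal (Real.exp (ε / 2 * ((N : ℝ) + 1))) * expMom (μ N) β (Y τ V N) := by
        unfold expMom
        rw [lintegral_const_mul' _ _ ENNReal.ofReal_ne_top]
    _ ≤ ENNReal.ofReal (Real.exp (ε / 2 * ((N : ℝ) + 1))) * ldBound (ε / 2) N := by gcongr; exact h N hN₁
    _ = ldBound ε N := by
        unfold ldBound
        rw [← ENNReal.ofReal_mul (by positivity), ← Real.exp_add]
        ring_nf

/-- Two one-sided data give the two-sided statement. -/
theorem TwoSidedLD.of_upper {Y : WFun} (hp : UpperLD μ Y) (hn : UpperLD μ (fun τ V N z => -Y τ V N z)) :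
    TwoSidedLD μ Y := by
  obtain ⟨V₁, hV₁, hp⟩ := hp.out
  obtain ⟨V₂, hV₂, hn⟩ := hn.out
  refine ⟨⟨⟨max V₁ V₂, lt_max_of_lt_left hV₁, fun V hV => ?_⟩⟩⟩
  obtain ⟨b₁, hb₁, hp⟩ := hp V ((le_max_left _ _).trans hV)
  obtain ⟨b₂, hb₂, hn⟩ := hn V ((le_max_right _ _).trans hV)
  refine ⟨min b₁ b₂, lt_min hb₁ hb₂, fun β hβ ε hε => ?_⟩
  rcases le_or_gt 0 β with hβ0 | hβ0
  · have hb : β ≤ b₁ := (le_abs_self β).trans (hβ.trans (min_le_left _ _))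
    obtain ⟨τ₀, hτ₀, hp⟩ := hp β hβ0 hb ε hε
    refine ⟨τ₀, hτ₀, fun τ hτ => ?_⟩
    obtain ⟨N₀, hp⟩ := hp τ hτ
    exact ⟨N₀, fun N hN => hp N hN⟩
  · have hb : -β ≤ b₂ := (neg_le_abs β).trans (hβ.trans (min_le_right _ _))
    obtain ⟨τ₀, hτ₀, hn⟩ := hn (-β) (by linarith) hb ε hε
    refine ⟨τ₀, hτ₀, fun τ hτ => ?_⟩
    obtain ⟨N₀, hn⟩ := hn τ hτ
    refine ⟨N₀, fun N hN => ?_⟩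
    have e := hn N hN
    rwa [expMom_neg, neg_neg] at e

/-- From a two-sided datum back to the one-sided ones. -/
theorem TwoSidedLD.upper {Y : WFun} (h : TwoSidedLD μ Y) : UpperLD μ Y := by
  obtain ⟨V₀, hV₀, h⟩ := h.out.out
  refine ⟨⟨V₀, hV₀, fun V hV => ?_⟩⟩
  obtain ⟨β₀, hβ₀, h⟩ := h V hV
  refine ⟨β₀, hβ₀, fun β hβ0 hβ ε hε => ?_⟩
  exact h β (abs_le.2 ⟨by linarith, hβ⟩) ε hε

/-- From a two-sided datum to the one-sided datum of `-Y`. -/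
theorem TwoSidedLD.upper_neg {Y : WFun} (h : TwoSidedLD μ Y) : UpperLD μ (fun τ V N z => -Y τ V N z) := by
  obtain ⟨V₀, hV₀, h⟩ := h.out.out
  refine ⟨⟨V₀, hV₀, fun V hV => ?_⟩⟩
  obtain ⟨β₀, hβ₀, h⟩ := h V hV
  refine ⟨β₀, hβ₀, fun β hβ0 hβ ε hε => ?_⟩
  obtain ⟨τ₀, hτ₀, h⟩ := h (-β) (abs_le.2 ⟨by linarith, by linarith⟩) ε hε
  refine ⟨τ₀, hτ₀, fun τ hτ => ?_⟩
  obtain ⟨N₀, h⟩ := h τ hτ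
  refine ⟨N₀, fun N hN => ?_⟩
  rw [expMom_neg]
  exact h N hN

/-- Registered anchor of this file: midpoint convexity of the exponential (= `exp_half_add_le`). -/
theorem radialVirialTemplate_exp_half_add_le (x y : ℝ) : Real.exp ((x + y) / 2) ≤ (Real.exp x + Real.exp y) / 2 :=
  exp_half_add_le x y

end Template

end RadialVirial

end Summit.AtomisticToContinuum.HydrodynamicLimit.Theorems.ClampedTransferCoin

end
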